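import Summits.BirchSwinnertonDyer.BirchSwinnertonDyer.Theorems.PrintX9JetchevX9Bridge
import Summits.BirchSwinnertonDyer.BirchSwinnertonDyer.Theorems.PrintX9JetchevX9CoreVertexExistence
import HarnessLib

/-!
# Route `PrintX9`, crux J = `HeegnerDivisibilityX9` (item 20392): the registered stub `stub_jetchevX9` (Jetchev 2008
# Thm. 1.4 `m_∞ ≥ ord_p c_q`, one carrier `q ∣ N_E` at a time, on every X9 Heegner frame of discriminant `|d_K| > 4`)
# ⟸ ONE READING `Prop52X9` (McCallum 1991 Prop. 5.2 at the X9 image) + THREE NAMED LITERATURE FACTS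
# {Gross 1991 Prop. 3.7 (2), Poitou–Tate for Selmer structures, [GZ86 III (3.1)] image-free}

Cell `bsd-print-x9` (print tier, key `x9`), prover seat p4; `--supports stmt-BirchSwinnertonDyer-20392`,
helper; THEOREMS ONLY, nothing booked, no item closed, BSD is not proved by any of this.

WHAT. `jetchevX9_of_prop52X9_of_namedFacts` = the X9 bridge `JET.Split.jetchevX9_of_readings_of_namedFacts`
(`PrintX9JetchevX9Bridge`) with its second reading `hCVX9` (Jetchev Prop. 5.3 «core vertices exist» on X9 rows)
DISCHARGED by the kernel theorem `JET.Split.coreVertexExistenceX9_of_namedFacts h37 hPT hF1`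
(`PrintX9JetchevX9CoreVertexExistence`: the Prop. 6.4 walk on X9 frames). So the single-carrier regime of crux J reads

  `stub_jetchevX9 ⟸ Prop52X9 ∧ GrossLMS1991.prop37_2_frobeniusCongruence ∧ (∀ K, poitouTate_selmerStructure_duality_conj K)
                  ∧ Gross1991_heegnerPoint_sub_ratTorsion_mem_E0_imageFree`,

where `Prop52X9` (the binder `h52X9`, displayed) is McCallum's Prop. 5.2 — Kolyvagin's redefinition of `m_∞` by the
PRIME SWAP — read at the irreducible NON-surjective X9 image: the one input of Jetchev's printed proof (Hypothesis (∗) =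
surjectivity enters only through the Čebotarev Cor. 3.2, UNCONDITIONAL on X9 frames, and through this swap) that is
neither print at such an image (McCallum 1991 §5 assumes `ρ̄` onto; the tree's fact
`McCallum1991.prop52_exists_conductor_kolyvaginClass_order_eq` carries the tower) nor yet a kernel theorem (strikes in
progress: bsd-jet pv-2 `Rank1ResidualJetSwap*`, bsd-stepL corner-p1 `ErratumRoadFiveNonSurjCornerKolyJSwap*` /
`kolyvaginRedefinition_of_swap`). Everything else of Jetchev §§3–6 at the X9 image is kernel-checked here modulo the three
named facts. CONDITIONAL on `h52X9` and the three facts; nothing asserted about any curve; the stub itself stays open.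
beyond-print: YES for the discharged part (Jetchev Thm. 5.2 + Prop. 5.3 at non-surjective irreducible image).
`swapX9_of_prop52X9`: the `(r, M_r)` reading implies the WEAKER `r`-free swap reading `SwapX9` of the sequel
`PrintX9JetchevX9SwapBridge` (recommended crux child for the planner's split).

References: [cite: Jetchev2008, Thm. 1.4 (p. 812), Thm. 5.2, Prop. 5.3, Rem. 6.2, proof of Thm. 1.1 (p. 824)]
[cite: McCallumLMS1991, §3 Cor. 3.2, §5 Prop. 5.2 (p. 304)] [cite: GrossLMS1991, Prop. 3.7 (2), §6] [cite: GrossZagier1986Heegner, III (3.1)].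
-/

set_option autoImplicit false

noncomputable section

open scoped Classical

namespace Summit.BirchSwinnertonDyer.Rank1Residual.JET.Split

open WeierstrassCurve Literature.NumberTheory.EllipticCurves
  Literature.NumberTheory.EllipticCurves.ModularForms
  Literature.NumberTheory.EllipticCurves.Rank1Residual
  Literature.NumberTheory.GaloisCohomology
  Summit.BirchSwinnertonDyer.Rank1Residual Summit.BirchSwinnertonDyer.Rank1Residual.JET
  Summit.BirchSwinnertonDyer.BirchSwinnertonDyer.Theorems

/-- **`stub_jetchevX9` (crux 20392, registered signature VERBATIM as conclusion) ⟸ `Prop52X9` + {Gross 1991 Prop. 3.7 (2),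
Poitou–Tate for Selmer structures, [GZ86 III (3.1)] image-free}** — the bridge `jetchevX9_of_readings_of_namedFacts` with the
core-vertex reading supplied by `coreVertexExistenceX9_of_namedFacts h37 hPT hF1`. CONDITIONAL on the reading `h52X9`
(McCallum Prop. 5.2 at the X9 image, displayed — no printed source at non-surjective image) and the three named facts;
nothing asserted. [cite: Jetchev2008, Thm. 1.4 (p. 812), Prop. 5.3, Thm. 5.2, Rem. 6.2] [cite: McCallumLMS1991, §5 Prop. 5.2 (p. 304)] -/
theorem jetchevX9_of_prop52X9_of_namedFacts
    (h52X9 : ∀ (W : WeierstrassCurve ℚ) [W.IsElliptic] [W.IsGloballyMinimal] [NeZero (W.conductorNorm ℤ)],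
        ∀ (K : Type) [Field K] [NumberField K], IsImaginaryQuadratic K →
        NumberField.discr K ≠ -3 → NumberField.discr K ≠ -4 →
        SatisfiesHeegnerHypothesis (W.conductorNorm ℤ) K →
        ∀ (p : ℕ) [Fact p.Prime], ClassX9 W p → SatisfiesHeegnerHypothesis p K →
        ∀ (Dt : ModularParametrizationData W (W.conductorNorm ℤ)) (β : ℤ) (ι : K →+* ℂ)
          (d₁ : KolyvaginHeegnerData Dt β ι 1), ¬ IsOfFinAddOrder d₁.derivedPoint →
        ∀ (r : ℕ), 0 < r →
        ∀ (Mr : ℕ),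
          IsLeast {u : ℕ | ∃ (n : ℕ) (d : KolyvaginHeegnerData Dt β ι n), Squarefree n ∧
              n.primeFactors.card = r ∧
              (∀ ℓ ∈ n.primeFactors, Zhang2014.IsKolyvaginPrime (W.conductorNorm ℤ) W K p ℓ ∧
                u + 1 ≤ Zhang2014.kolyvaginIndex W p ℓ) ∧
              (∃ Q : (W.baseChange (ringClassField K ι n)).toAffine.Point,
                ((p ^ u : ℕ) : ℤ) • Q = d.derivedPoint) ∧
              ¬ ∃ Q : (W.baseChange (ringClassField K ι n)).toAffine.Point,
                ((p ^ (u + 1) : ℕ) : ℤ) • Q = d.derivedPoint} Mr →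
        ∀ (M : ℕ), Mr < M →
          ∃ (n : ℕ) (d : KolyvaginHeegnerData Dt β ι n), Squarefree n ∧ n.primeFactors.card = r ∧
            (∀ ℓ ∈ n.primeFactors, Zhang2014.IsKolyvaginPrime (W.conductorNorm ℤ) W K p ℓ ∧
              M ≤ Zhang2014.kolyvaginIndex W p ℓ) ∧
            addOrderOf (d.kolyvaginClass (Fact.out : p.Prime) M) = p ^ (M - Mr) ∧
            (∃ Q : (W.baseChange (ringClassField K ι n)).toAffine.Point,
              ((p ^ Mr : ℕ) : ℤ) • Q = d.derivedPoint) ∧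
            ¬ ∃ Q : (W.baseChange (ringClassField K ι n)).toAffine.Point,
              ((p ^ (Mr + 1) : ℕ) : ℤ) • Q = d.derivedPoint)
    -- THREE NAMED LITERATURE FACTS
    (h37 : GrossLMS1991.prop37_2_frobeniusCongruence)
    (hPT : ∀ (K : Type) [Field K] [NumberField K], poitouTate_selmerStructure_duality_conj K)
    (hF1 : Gross1991_heegnerPoint_sub_ratTorsion_mem_E0_imageFree) :
    ∀ (W : WeierstrassCurve ℚ) [W.IsElliptic] [W.IsGloballyMinimal] [NeZero (W.conductorNorm ℤ)] (p : ℕ)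
      [Fact p.Prime], Literature.NumberTheory.EllipticCurves.Rank1Residual.ClassX9 W p → W.analyticRank ≤ 1 →
      ∃ B : ℕ, ∀ (K : Type) [Field K] [NumberField K]
        (Dt : Literature.NumberTheory.EllipticCurves.ModularForms.ModularParametrizationData W (W.conductorNorm ℤ))
        (β : ℤ) (ι : K →+* ℂ), Literature.NumberTheory.EllipticCurves.IsImaginaryQuadratic K →
        B < (NumberField.discr K).natAbs →
        Literature.NumberTheory.EllipticCurves.SatisfiesHeegnerHypothesis (W.conductorNorm ℤ) K →
        Literature.NumberTheory.EllipticCurves.SatisfiesHeegnerHypothesis p K →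
        (4 * (W.conductorNorm ℤ : ℤ)) ∣ β ^ 2 - NumberField.discr K → ¬ (p : ℤ) ∣ Dt.c →
        ∀ (d₁ : Literature.NumberTheory.EllipticCurves.KolyvaginHeegnerData Dt β ι 1),
          ¬ IsOfFinAddOrder d₁.derivedPoint →
        ∀ (q : ℕ) [Fact q.Prime], q ∣ W.conductorNorm ℤ →
        ∀ (s : ℕ), s ≤ padicValNat p ((W.baseChange ℚ_[q]).localTamagawaNumber ℤ_[q]) →
        ∀ (n : ℕ) (d : Literature.NumberTheory.EllipticCurves.KolyvaginHeegnerData Dt β ι n), Squarefree n →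
          (∀ ℓ ∈ n.primeFactors,
            Literature.NumberTheory.EllipticCurves.Zhang2014.IsKolyvaginPrime (W.conductorNorm ℤ) W K p ℓ ∧
              s ≤ Literature.NumberTheory.EllipticCurves.Zhang2014.kolyvaginIndex W p ℓ) →
          ∃ Q : (W.baseChange (Literature.NumberTheory.EllipticCurves.ringClassField K ι n)).toAffine.Point,
            ((p ^ s : ℕ) : ℤ) • Q = d.derivedPoint :=
  jetchevX9_of_readings_of_namedFacts h52X9 (coreVertexExistenceX9_of_namedFacts h37 hPT hF1) h37 hPT hF1

/-! ### McCallum's `(r, M_r)` reading implies the `r`-free swap reading -/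

/-- **`Prop52X9 ⟹ SwapX9`**: McCallum 1991 Prop. 5.2 read at the X9 image (the `(r, M_r)` form `h52X9`) implies
corner-p1's `r`-free prime swap on X9 frames (the binder `hswapX9` of `jetchevX9_of_swapX9_of_namedFacts`,
`PrintX9JetchevX9SwapBridge`): given `M`, a bound `e` and an admissible `(n, d)` of index `≥ M + 1` with `p^{M+1} ∤ P_n`,
all admissible derived points of index `≥ M + 1` being `p^M`-divisible, either `n = 1` (then `(1, d)` itself is deep) or,
with `r ≥ 1` the number of primes of `n`, `M ∈ S_r`, so `M_r ≤ M`, and Prop. 5.2 at `M' := max e (M + 1)` gives `(n', d')`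
of index `≥ M'` with `p^{M_r} ∥ P_{n'}`; since `P_{n'}` is `p^M`-divisible, `M ≤ M_r`, so `p^{M+1} ∤ P_{n'}`. Hence `SwapX9`
is the WEAKER of the two displayed readings. [cite: McCallumLMS1991, §5 Prop. 5.2 (p. 304)] [cite: BurungaleEtAl2026, Prop. 2.2.1] -/
theorem swapX9_of_prop52X9
    (h52X9 : ∀ (W : WeierstrassCurve ℚ) [W.IsElliptic] [W.IsGloballyMinimal] [NeZero (W.conductorNorm ℤ)],
        ∀ (K : Type) [Field K] [NumberField K], IsImaginaryQuadratic K →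
        NumberField.discr K ≠ -3 → NumberField.discr K ≠ -4 →
        SatisfiesHeegnerHypothesis (W.conductorNorm ℤ) K →
        ∀ (p : ℕ) [Fact p.Prime], ClassX9 W p → SatisfiesHeegnerHypothesis p K →
        ∀ (Dt : ModularParametrizationData W (W.conductorNorm ℤ)) (β : ℤ) (ι : K →+* ℂ)
          (d₁ : KolyvaginHeegnerData Dt β ι 1), ¬ IsOfFinAddOrder d₁.derivedPoint →
        ∀ (r : ℕ), 0 < r →
        ∀ (Mr : ℕ),
          IsLeast {u : ℕ | ∃ (n : ℕ) (d : KolyvaginHeegnerData Dt β ι n), Squarefree n ∧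
              n.primeFactors.card = r ∧
              (∀ ℓ ∈ n.primeFactors, Zhang2014.IsKolyvaginPrime (W.conductorNorm ℤ) W K p ℓ ∧
                u + 1 ≤ Zhang2014.kolyvaginIndex W p ℓ) ∧
              (∃ Q : (W.baseChange (ringClassField K ι n)).toAffine.Point,
                ((p ^ u : ℕ) : ℤ) • Q = d.derivedPoint) ∧
              ¬ ∃ Q : (W.baseChange (ringClassField K ι n)).toAffine.Point,
                ((p ^ (u + 1) : ℕ) : ℤ) • Q = d.derivedPoint} Mr →
        ∀ (M : ℕ), Mr < M →
          ∃ (n : ℕ) (d : KolyvaginHeegnerData Dt β ι n), Squarefree n ∧ n.primeFactors.card = r ∧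
            (∀ ℓ ∈ n.primeFactors, Zhang2014.IsKolyvaginPrime (W.conductorNorm ℤ) W K p ℓ ∧
              M ≤ Zhang2014.kolyvaginIndex W p ℓ) ∧
            addOrderOf (d.kolyvaginClass (Fact.out : p.Prime) M) = p ^ (M - Mr) ∧
            (∃ Q : (W.baseChange (ringClassField K ι n)).toAffine.Point,
              ((p ^ Mr : ℕ) : ℤ) • Q = d.derivedPoint) ∧
            ¬ ∃ Q : (W.baseChange (ringClassField K ι n)).toAffine.Point,
              ((p ^ (Mr + 1) : ℕ) : ℤ) • Q = d.derivedPoint) :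
    ∀ (W : WeierstrassCurve ℚ) [W.IsElliptic] [W.IsGloballyMinimal] [NeZero (W.conductorNorm ℤ)],
        ∀ (K : Type) [Field K] [NumberField K], IsImaginaryQuadratic K →
        NumberField.discr K ≠ -3 → NumberField.discr K ≠ -4 →
        SatisfiesHeegnerHypothesis (W.conductorNorm ℤ) K →
        ∀ (p : ℕ) [Fact p.Prime], ClassX9 W p → SatisfiesHeegnerHypothesis p K →
        ∀ (Dt : ModularParametrizationData W (W.conductorNorm ℤ)) (β : ℤ) (ι : K →+* ℂ)
          (d₁ : KolyvaginHeegnerData Dt β ι 1), ¬ IsOfFinAddOrder d₁.derivedPoint →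
        ∀ (M e : ℕ) (n : ℕ) (d : KolyvaginHeegnerData Dt β ι n), Squarefree n →
          (∀ ℓ ∈ n.primeFactors, Zhang2014.IsKolyvaginPrime (W.conductorNorm ℤ) W K p ℓ ∧
            M + 1 ≤ Zhang2014.kolyvaginIndex W p ℓ) →
          (∀ (n' : ℕ) (d' : KolyvaginHeegnerData Dt β ι n'), Squarefree n' →
            (∀ ℓ ∈ n'.primeFactors, Zhang2014.IsKolyvaginPrime (W.conductorNorm ℤ) W K p ℓ ∧
              M + 1 ≤ Zhang2014.kolyvaginIndex W p ℓ) →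
            ∃ Q : (W.baseChange (ringClassField K ι n')).toAffine.Point, ((p ^ M : ℕ) : ℤ) • Q = d'.derivedPoint) →
          (¬ ∃ Q : (W.baseChange (ringClassField K ι n)).toAffine.Point,
            ((p ^ (M + 1) : ℕ) : ℤ) • Q = d.derivedPoint) →
          ∃ (n' : ℕ) (d' : KolyvaginHeegnerData Dt β ι n'), Squarefree n' ∧
            (∀ ℓ ∈ n'.primeFactors, Zhang2014.IsKolyvaginPrime (W.conductorNorm ℤ) W K p ℓ ∧
              e ≤ Zhang2014.kolyvaginIndex W p ℓ) ∧
            ¬ ∃ Q : (W.baseChange (ringClassField K ι n')).toAffine.Point,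
              ((p ^ (M + 1) : ℕ) : ℤ) • Q = d'.derivedPoint := by
  intro W _ _ _ K _ _ hK hD3 hD4 hH p _ hX9 hHp Dt β ι d₁ hy M e n d hn hidx hall hnd
  have hp : p.Prime := Fact.out
  by_cases hr : n.primeFactors.card = 0
  · -- `n = 1`: the conductor `1` lies above every index bound
    have hn1 : n = 1 := by
      rcases Nat.primeFactors_eq_empty.mp (Finset.card_eq_zero.mp hr) with h | h
      · exact absurd h hn.ne_zero
      · exact h
    subst hn1
    exact ⟨1, d, hn, fun ℓ hℓ ↦ by simp at hℓ, hnd⟩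
  · -- `r ≥ 1`: `M ∈ S_r`, `M_r = min S_r ≤ M`, Prop. 5.2 at `max e (M + 1)`
    have hr0 : 0 < n.primeFactors.card := Nat.pos_of_ne_zero hr
    let T : ℕ → Prop := fun u ↦ ∃ (n'' : ℕ) (d'' : KolyvaginHeegnerData Dt β ι n''), Squarefree n'' ∧
        n''.primeFactors.card = n.primeFactors.card ∧
        (∀ ℓ ∈ n''.primeFactors, Zhang2014.IsKolyvaginPrime (W.conductorNorm ℤ) W K p ℓ ∧
          u + 1 ≤ Zhang2014.kolyvaginIndex W p ℓ) ∧
        (∃ Q : (W.baseChange (ringClassField K ι n'')).toAffine.Point,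
          ((p ^ u : ℕ) : ℤ) • Q = d''.derivedPoint) ∧
        ¬ ∃ Q : (W.baseChange (ringClassField K ι n'')).toAffine.Point,
          ((p ^ (u + 1) : ℕ) : ℤ) • Q = d''.derivedPoint
    have hMT : T M := ⟨n, d, hn, rfl, hidx, hall n d hn hidx, hnd⟩
    have hT : ∃ u, T u := ⟨M, hMT⟩
    set Mr : ℕ := Nat.find hT with hMrdef
    have hleast : IsLeast {u : ℕ | T u} Mr := ⟨Nat.find_spec hT, fun u hu ↦ Nat.find_min' hT hu⟩
    have hMrM : Mr ≤ M := Nat.find_min' hT hMT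
    have hlt : Mr < max e (M + 1) := lt_of_le_of_lt hMrM (lt_of_lt_of_le (Nat.lt_succ_self M) (le_max_right _ _))
    obtain ⟨n', d', hsq', -, hidx', -, -, hndiv'⟩ :=
      h52X9 W K hK hD3 hD4 hH p hX9 hHp Dt β ι d₁ hy n.primeFactors.card hr0 Mr hleast (max e (M + 1)) hlt
    have hidxM : ∀ ℓ ∈ n'.primeFactors, Zhang2014.IsKolyvaginPrime (W.conductorNorm ℤ) W K p ℓ ∧
        M + 1 ≤ Zhang2014.kolyvaginIndex W p ℓ :=
      fun ℓ hℓ ↦ ⟨(hidx' ℓ hℓ).1, le_trans (le_max_right _ _) (hidx' ℓ hℓ).2⟩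
    -- `P_{n'}` is `p^M`-divisible (all deep conductors are), so `M ≤ M_r`
    have hMle : M ≤ Mr := by
      by_contra h
      have h1 : Mr + 1 ≤ M := by omega
      exact hndiv' (exists_pow_smul_eq_of_le p h1 (hall n' d' hsq' hidxM))
    have hMeq : Mr = M := le_antisymm hMrM hMle
    refine ⟨n', d', hsq', fun ℓ hℓ ↦ ⟨(hidx' ℓ hℓ).1, le_trans (le_max_left _ _) (hidx' ℓ hℓ).2⟩, ?_⟩
    rw [← hMeq]
    exact hndiv'

end Summit.BirchSwinnertonDyer.Rank1Residual.JET.Split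

end
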